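import Literature.NumberTheory.EllipticCurves.StrictSelmerRankOne
import Literature.NumberTheory.EllipticCurves.KummerMap
import Literature.NumberTheory.EllipticCurves.KummerSelmerStructure
import Literature.NumberTheory.EllipticCurves.SelmerProofs
import HarnessLib

/-!
# Rank one and finite `Ш[p^∞]`: a UNIFORM annihilator of the `p`-strict `p^k`-Selmer classes

Trunk `Literature/NumberTheory/EllipticCurves`; `Proofs`-style file (theorems only: no definition,
no named fact, no `sorry`, no instance).  Companion of `StrictSelmerRankOne.lean`
(`finite_strictSelmer_of_mordellWeilRank_eq_one`, the `p^∞`-currency statement: the `p`-strict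
`p^∞`-Selmer group is finite) at FINITE LEVEL `n = p^k`, with the bound UNIFORM in `k`:

* `exists_baseChange_eq_zsmul_of_res_kummerMapTorsion_eq_zero` — over any field `K` and any
  perfect `K`-field `E` (a completion): if the `n`-Kummer class `κ_n(P) = [σ ↦ σQ − Q]`
  (`kummerMapTorsion`, `nQ = P`) of `P ∈ E(K)` restricts to `0` in `H¹(Γ_E, E[n])`
  (`galoisCohomology.res (W.torsionGaloisModule n) E 1`), then `P ∈ n·E(E)`
  (Galois descent over `E`; no torsion ambiguity at finite level since `E[n]` is killed by `n`);
* `exists_uniform_nsmul_eq_zero_of_mem_selmerGroup_of_res_eq_zero` — for an elliptic curve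
  `E/K` over a number field with `rank_ℤ E(K) = 1` and `Ш(E/K)[p^∞]` finite, and a perfect
  `K`-field `E` carrying `λ : E(E) → ℤ_p` vanishing exactly on torsion (e.g. `E = ℚ_p`, AEC VII.6.3):
  there is ONE integer `M ≠ 0` such that for EVERY `k` and every `d ∈ Sel^{(p^k)}(E/K)` restricting
  to `0` in `H¹(Γ_E, E[p^k])`, `M·d = 0`.

## The argument (Skinner, Ann. of Math. 191 (2020) §2.2 Lemma `rank1lemma`; Kim, Math. Ann. 387
(2022) §1; elementary Kummer theory, Silverman AEC VIII.§2, X.§4 — at finite level)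

`Sel^{(n)} ↦ Ш(E/K) ∩ H¹(K,E)[n]` under `H¹(K,E[n]) → H¹(K,E)` (`map_torsionH1ToH1_selmerGroup_holds`),
and `Ш[n] ⊆ Ш[p^∞]` (`n = p^k`) is killed by `s = #Ш[p^∞]`; so `s·d` dies in `H¹(K,E)` and is a
Kummer class `κ_n(P)` (`mem_range_kummerMapTorsion_of_torsionH1ToH1_eq_zero`).  Its restriction to
`Γ_E` vanishes, so `P = nR` in `E(E)`.  With `E(K) = ℤP₁ + E(K)_tors` (`exists_generator_of_mordellWeilRank_eq_one`)
write `P = aP₁ + t`; applying `λ` gives `p^k ∣ a·λ(P₁)` in `ℤ_p`, whence `p^{k − v} ∣ a` with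
`v = v_p(λ(P₁))` (`pow_sub_valuation_dvd_of_pow_dvd_mul`); as `p^k` kills `H¹(K,E[p^k])` and
`m₀ = #E(K)_tors` kills `κ_n(t) = κ_n`-of-torsion, `p^v·m₀·κ_n(P) = 0`.  Hence
`M = s·p^v·m₀` works for every `k`.

## References

* [Skinner2020] C. Skinner, Ann. of Math. 191 (2020), §2.2 (Lemma `rank1lemma`), §3.
* [Kim2022] C.-H. Kim, Math. Ann. 387 (2022), §1 (before Cor. 1.4), Prop. 2.10.
* [SilvermanAEC2009] J. H. Silverman, *AEC* (2009), VIII.§2 (Kummer pairing), X.§4, VII.6.3.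
* [Greenberg1999LNM] R. Greenberg, LNM 1716 (1999), §2 pp. 62–63.
-/

noncomputable section

open scoped Classical

open WeierstrassCurve Literature.NumberTheory.GaloisRepresentations

universe u

namespace Literature.NumberTheory.EllipticCurves

/-! ### 1. Local triviality of a finite-level Kummer class forces divisibility -/

/-- **`res_E κ_n(P) = 0 ⇒ P ∈ n·E(E)`.** For `P ∈ E(K)`, `n ≠ 0`, and the `n`-Kummer class
`κ_n(P) = [σ ↦ σQ − Q]` (`nQ = P` in `E(K̄)`): if its restriction to `H¹(Γ_E, E[n])` vanishes
(`E` a perfect `K`-field), the restricted cocycle is `τ ↦ τT − T` for some `T ∈ E[n]`, so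
`ι(Q) − ι(T)` is `Γ_E`-fixed in `E(Ē)` and comes from some `R ∈ E(E)`
(`exists_map_eq_of_forall_smul_localPoints_eq`); multiplying by `n` kills `T` and gives `P = nR` in
`E(E)` (`E(E) → E(Ē)` injective). Silverman, *AEC*, VIII.§2 and X.§4 (exactness of the local
Kummer sequence at `E(K_v)/nE(K_v)`). [cite: SilvermanAEC2009, VIII.§2 and X.§4 diagram (**)] -/
theorem exists_baseChange_eq_zsmul_of_res_kummerMapTorsion_eq_zero {K : Type u} [Field K]
    (W : WeierstrassCurve K) {n : ℤ}
    (hdiv : ∀ P : geomPoints W, ∃ Q : geomPoints W, n • Q = P)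
    (E : Type u) [Field E] [Algebra K E] [PerfectField E] (P : W.toAffine.Point)
    (h : galoisCohomology.res (W.torsionGaloisModule n) E 1 (kummerMapTorsion W n hdiv P) = 0) :
    ∃ R : (W.baseChange E).toAffine.Point, Affine.Point.baseChange (W' := W) K E P = n • R := by
  obtain ⟨Q, hQ⟩ := hdiv (toGeomPoints W P)
  have hQfix : n • Q ∈ MulAction.fixedPoints (Field.absoluteGaloisGroup K) (geomPoints W) := by
    rw [hQ]; exact toGeomPoints_mem_fixedPoints W P
  rw [kummerMapTorsion_apply, kummerMapTorsionFun_eq W n hdiv P Q hQ] at h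
  unfold kummerClassTorsion at h
  rw [res_torsionGaloisModule_oneCocycleClass] at h
  obtain ⟨T, hT⟩ := (oneCocycleClass_eq_zero_iff _ _).mp h
  -- on points of `E(K̄)`: `resGal τ • Q - Q = resGal τ • T - T`
  have hT' : ∀ τ : Field.absoluteGaloisGroup E,
      resGal (K := K) E τ • Q - Q = resGal (K := K) E τ • (T : geomPoints W) - T := fun τ => by
    have h1 := congrArg (fun S : geomTorsion W n => (S : geomPoints W)) (hT τ)
    rw [resGal_eq_absGaloisRestrict]
    exact h1
  have hfix : ∀ τ : Field.absoluteGaloisGroup E,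
      τ • (pointsMap W E (Q - (T : geomPoints W))) = pointsMap W E (Q - (T : geomPoints W)) := by
    intro τ
    rw [← pointsMap_smul, smul_sub, sub_eq_sub_iff_sub_eq_sub.mpr (hT' τ)]
  obtain ⟨R, hR⟩ := exists_map_eq_of_forall_smul_localPoints_eq W E hfix
  refine ⟨R, ?_⟩
  have hjP : (Affine.Point.map (W' := W) (IsScalarTower.toAlgHom K E (AlgebraicClosure E))
      (Affine.Point.baseChange (W' := W) K E P) : localPoints W E) =
        pointsMap W E (toGeomPoints W P) := by
    change Affine.Point.map _ (Affine.Point.baseChange (W' := W) K E P) =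
      Affine.Point.map (closureEmb (K := K) E)
        (Affine.Point.baseChange (W' := W) K (AlgebraicClosure K) P)
    rw [Affine.Point.map_baseChange, Affine.Point.map_baseChange]
  have hnT : n • (T : geomPoints W) = 0 := (mem_geomTorsion_iff W n _).mp T.2
  have h2 : n • (Q - (T : geomPoints W)) = toGeomPoints W P := by
    rw [smul_sub, hnT, sub_zero, hQ]
  have key : pointsMap W E (toGeomPoints W P) = pointsMap W E (n • (Q - (T : geomPoints W))) := by
    rw [h2]
  apply Affine.Point.map_injective (W' := W) (IsScalarTower.toAlgHom K E (AlgebraicClosure E))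
  rw [hjP, key, map_zsmul (pointsMap W E), ← hR, map_zsmul]
  rfl

/-! ### 2. Two torsion bookkeeping lemmas -/

/-- `H¹(K, E[m])` (`m : ℕ`, coefficients the `m`-torsion) is killed by `m`: a continuous crossed
homomorphism with values in `E[m]` has `m`-torsion values (`nsmul_oneCocycleClass_eq_zero`).
Silverman, *AEC*, VIII.§2 (`H¹(G, E[m])` in the Kummer sequence is an `m`-torsion group).
[cite: SilvermanAEC2009, VIII.§2] -/
theorem nsmul_galH1Torsion_natCast_eq_zero {K : Type u} [Field K] (W : WeierstrassCurve K)
    (m : ℕ) (z : galH1Torsion W (m : ℤ)) : m • z = 0 := by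
  obtain ⟨φ, rfl⟩ := oneCocycleClass_surjective _ z
  refine nsmul_oneCocycleClass_eq_zero φ m fun g => Subtype.ext ?_
  rw [AddSubgroupClass.coe_nsmul, ZeroMemClass.coe_zero, ← natCast_zsmul]
  exact (mem_geomTorsion_iff W (m : ℤ) _).mp (φ.1 g).2

/-- **The torsion of `E(K)` has a uniform exponent** (`K` a number field): there is `m₀ ≠ 0` with
`m₀·t = 0` for every point `t` of finite order — `E(K)` is finitely generated (Mordell–Weil,
`module_finite_point_holds`), so its torsion subgroup is finitely generated and torsion, hence
finite (`AddCommGroup.finite_of_fg_torsion`), and its order kills it. Silverman, *AEC*, VIII.6.7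
and Cor. III.6.4. [cite: SilvermanAEC2009, Thm. VIII.6.7] -/
theorem exists_nsmul_eq_zero_of_isOfFinAddOrder {K : Type u} [Field K] [NumberField K]
    (W : WeierstrassCurve K) [W.IsElliptic] :
    ∃ m₀ : ℕ, m₀ ≠ 0 ∧ ∀ t : W.toAffine.Point, IsOfFinAddOrder t → m₀ • t = 0 := by
  haveI : Module.Finite ℤ W.toAffine.Point := by convert W.module_finite_point_holds
  let Tor : AddSubgroup W.toAffine.Point := (Submodule.torsion ℤ W.toAffine.Point).toAddSubgroup
  haveI : Module.Finite ℤ (Submodule.torsion ℤ W.toAffine.Point) :=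
    Module.Finite.of_injective (Submodule.torsion ℤ W.toAffine.Point).subtype
      Subtype.val_injective
  haveI : AddGroup.FG Tor :=
    Module.Finite.iff_addGroup_fg.mp (inferInstanceAs (Module.Finite ℤ (Submodule.torsion ℤ _)))
  haveI : Finite Tor := by
    refine AddCommGroup.finite_of_fg_torsion Tor fun x => ?_
    have hx : (x : W.toAffine.Point) ∈ Submodule.torsion ℤ W.toAffine.Point := x.2
    rw [Submodule.mem_torsion_iff] at hx
    obtain ⟨a, ha⟩ := hx
    have ha' : (a : ℤ) • (x : W.toAffine.Point) = 0 := ha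
    refine isOfFinAddOrder_iff_zsmul_eq_zero.mpr ⟨a, nonZeroDivisors.coe_ne_zero a, Subtype.ext ?_⟩
    rw [AddSubgroupClass.coe_zsmul, ZeroMemClass.coe_zero]
    exact ha'
  refine ⟨Nat.card Tor, Nat.card_pos.ne', fun t ht => ?_⟩
  have htmem : t ∈ Tor := by
    obtain ⟨m, hm, hmt⟩ := isOfFinAddOrder_iff_nsmul_eq_zero.mp ht
    change t ∈ Submodule.torsion ℤ W.toAffine.Point
    rw [Submodule.mem_torsion_iff]
    refine ⟨⟨(m : ℤ), mem_nonZeroDivisors_of_ne_zero (Int.natCast_ne_zero.mpr hm.ne')⟩, ?_⟩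
    change ((m : ℤ)) • t = 0
    rw [natCast_zsmul, hmt]
  have h := card_nsmul_eq_zero' (G := Tor) (x := ⟨t, htmem⟩)
  exact congrArg Subtype.val h

/-! ### 3. The uniform annihilator -/

/-- **Rank one and finite `Ш[p^∞]`: ONE integer kills every locally-trivial-at-`E` `p^k`-Selmer
class, for all `k` at once.** Let `E/K` be an elliptic curve over a number field with
`rank_ℤ E(K) = 1` and `Ш(E/K)[p^∞]` finite, and `E` a perfect `K`-field with `λ : E(E) → ℤ_p`
vanishing exactly on torsion. Then there is `M ≠ 0` such that for every `k` and every
`d ∈ Sel^{(p^k)}(E/K)` with `res_E d = 0` in `H¹(Γ_E, E[p^k])`: `M·d = 0`. (Finite-level, uniform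
form of Skinner's Lemma `rank1lemma` / Kim's remark before Cor. 1.4: `s·d = κ(P)` with
`s = #Ш[p^∞]`, `P = p^k R` in `E(E)`, `P = aP₁ + t`, `p^{k−v_p(λ P₁)} ∣ a`.)
[cite: Skinner2020, §2.2 (Lemma rank1lemma) and §3] [cite: Kim2022, §1 (sentence preceding Cor. 1.4)] -/
theorem exists_uniform_nsmul_eq_zero_of_mem_selmerGroup_of_res_eq_zero
    {K : Type u} [Field K] [NumberField K] (W : WeierstrassCurve K) [W.IsElliptic]
    (p : ℕ) [Fact p.Prime] (E : Type u) [Field E] [Algebra K E] [PerfectField E]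
    (lam : (W.baseChange E).toAffine.Point →+ ℤ_[p]) (hlam : ∀ X, lam X = 0 ↔ IsOfFinAddOrder X)
    (hrank : W.mordellWeilRank = 1) [Finite (AddCommGroup.primaryComponent W.sha p)] :
    ∃ M : ℕ, M ≠ 0 ∧ ∀ (k : ℕ) (d : galH1Torsion W ((p : ℤ) ^ k)),
      d ∈ selmerGroup W ((p : ℤ) ^ k) →
        galoisCohomology.res (W.torsionGaloisModule ((p : ℤ) ^ k)) E 1 d = 0 →
          M • d = 0 := by
  have hp : p.Prime := Fact.out
  -- the rank-one generator and the valuation of `λ(P₁)`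
  obtain ⟨P₁, hP₁, hgen⟩ := exists_generator_of_mordellWeilRank_eq_one W hrank
  let bc : W.toAffine.Point →+ (W.baseChange E).toAffine.Point :=
    Affine.Point.baseChange (W' := W) K E
  have hinj : Function.Injective bc := Affine.Point.map_injective (W' := W) (Algebra.ofId K E)
  have htors : ∀ {x : W.toAffine.Point}, IsOfFinAddOrder x → IsOfFinAddOrder (bc x) := fun hx => by
    obtain ⟨n, hn, hnx⟩ := isOfFinAddOrder_iff_nsmul_eq_zero.mp hx
    exact isOfFinAddOrder_iff_nsmul_eq_zero.mpr ⟨n, hn, by rw [← map_nsmul, hnx, map_zero]⟩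
  have hu0 : lam (bc P₁) ≠ 0 := by
    intro h0
    apply hP₁
    obtain ⟨n, hn, hnP⟩ := isOfFinAddOrder_iff_nsmul_eq_zero.mp ((hlam _).mp h0)
    refine isOfFinAddOrder_iff_nsmul_eq_zero.mpr ⟨n, hn, hinj ?_⟩
    rw [map_nsmul, map_zero]
    exact hnP
  set v : ℕ := (lam (bc P₁)).valuation with hv
  -- the torsion exponent of `E(K)` and the order of `Ш[p^∞]`
  obtain ⟨m₀, hm₀, hm₀t⟩ := exists_nsmul_eq_zero_of_isOfFinAddOrder W
  set s : ℕ := Nat.card (AddCommGroup.primaryComponent W.sha p) with hs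
  have hs0 : s ≠ 0 := Nat.card_pos.ne'
  refine ⟨s * (p ^ v * m₀), Nat.mul_ne_zero hs0 (Nat.mul_ne_zero (pow_ne_zero v hp.ne_zero) hm₀),
    fun k d hd hres => ?_⟩
  -- the restriction at `E`, as an additive map out of `H¹(K, E[p^k])`
  let r : galH1Torsion W ((p : ℤ) ^ k) →+
      galoisCohomology (GaloisRep.restrictField E (W.torsionGaloisModule ((p : ℤ) ^ k))) 1 :=
    galoisCohomology.res (W.torsionGaloisModule ((p : ℤ) ^ k)) E 1
  have hres' : r d = 0 := hres
  have hn0 : ((p : ℤ) ^ k) ≠ 0 := pow_ne_zero k (Int.natCast_ne_zero.mpr hp.ne_zero)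
  have hdiv : ∀ P : geomPoints W, ∃ Q : geomPoints W, ((p : ℤ) ^ k) • Q = P :=
    fun P => W.zsmul_geomPoints_surjective_holds hn0 P
  -- (i) `s • d` dies in `H¹(K, E)`: its image lies in `Ш ∩ H¹(K,E)[p^k] ⊆ Ш[p^∞]`
  have himg : torsionH1ToH1 W _ d ∈ W.sha ⊓ AddSubgroup.torsionBy W.galH1 ((p : ℤ) ^ k) := by
    rw [← W.map_torsionH1ToH1_selmerGroup_holds hn0]
    exact AddSubgroup.mem_map_of_mem _ hd
  have hprim : (⟨torsionH1ToH1 W _ d, himg.1⟩ : W.sha) ∈ AddCommGroup.primaryComponent W.sha p := by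
    refine (AddCommGroup.mem_primaryComponent).mpr ⟨k, Subtype.ext ?_⟩
    have h2 : ((p : ℤ) ^ k) • torsionH1ToH1 W _ d = 0 := himg.2
    rw [AddSubgroupClass.coe_nsmul, ZeroMemClass.coe_zero, ← natCast_zsmul, Nat.cast_pow]
    exact h2
  have hsd : torsionH1ToH1 W _ (s • d) = 0 := by
    have h := card_nsmul_eq_zero' (G := AddCommGroup.primaryComponent W.sha p)
      (x := ⟨⟨torsionH1ToH1 W _ d, himg.1⟩, hprim⟩)
    have h' := congrArg (fun z : AddCommGroup.primaryComponent W.sha p => ((z : W.sha) : W.galH1)) h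
    simp only [AddSubgroupClass.coe_nsmul, ZeroMemClass.coe_zero] at h'
    rw [map_nsmul]
    exact h'
  -- (ii) so `s • d = κ_n(P)`, locally trivial at `E`, hence `P = p^k R` in `E(E)`
  obtain ⟨P, hP⟩ := mem_range_kummerMapTorsion_of_torsionH1ToH1_eq_zero W _ hdiv (s • d) hsd
  have hresP : galoisCohomology.res (W.torsionGaloisModule ((p : ℤ) ^ k)) E 1
      (kummerMapTorsion W _ hdiv P) = 0 := by
    change r (kummerMapTorsion W _ hdiv P) = 0
    rw [hP, map_nsmul, hres', smul_zero]
  obtain ⟨R, hR⟩ := exists_baseChange_eq_zsmul_of_res_kummerMapTorsion_eq_zero W hdiv E P hresP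
  -- (iii) `P = a P₁ + t`, and `p^k ∣ a · λ(P₁)`
  obtain ⟨a, t, ht, rfl⟩ := hgen P
  have hdvd : (p : ℤ_[p]) ^ k ∣ (a : ℤ_[p]) * lam (bc P₁) := by
    have h1 := congrArg lam hR
    change lam (bc (a • P₁ + t)) = lam (((p : ℤ) ^ k) • R) at h1
    simp only [map_add, map_zsmul] at h1
    rw [(hlam _).mpr (htors ht), add_zero] at h1
    refine ⟨lam R, ?_⟩
    rw [← zsmul_eq_mul, h1, zsmul_eq_mul, Int.cast_pow, Int.cast_natCast]
  obtain ⟨a', ha'⟩ := pow_sub_valuation_dvd_of_pow_dvd_mul p hu0 hdvd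
  -- (iv) `p^v • (a • κ(P₁)) = 0` and `m₀ • κ(t) = 0`
  have hkill : ∀ z : galH1Torsion W ((p : ℤ) ^ k), p ^ k • z = 0 := fun z => by
    have h := nsmul_galH1Torsion_natCast_eq_zero W (p ^ k)
    rw [Nat.cast_pow] at h
    exact h z
  have hPart1 : p ^ v • (a • kummerMapTorsion W _ hdiv P₁) = 0 := by
    rcases le_or_gt k v with hle | hlt
    · obtain ⟨j, hj⟩ := Nat.exists_eq_add_of_le hle
      rw [hj, add_comm, pow_add, mul_nsmul', smul_comm (p ^ k) a, hkill, zsmul_zero, nsmul_zero]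
    · have ha'' : a = ((p ^ (k - v) : ℕ) : ℤ) * a' := by rw [ha']; push_cast; ring
      rw [ha'', mul_comm, ← smul_smul, natCast_zsmul, smul_comm (p ^ v), ← mul_nsmul', ← pow_add,
        Nat.add_sub_cancel' hlt.le, hkill, zsmul_zero]
  have hPart2 : m₀ • kummerMapTorsion W _ hdiv t = 0 := by
    rw [← map_nsmul, hm₀t t ht, map_zero]
  -- (v) assemble
  calc (s * (p ^ v * m₀)) • d = (p ^ v * m₀) • (s • d) := by rw [mul_comm, mul_nsmul']
    _ = (p ^ v * m₀) • kummerMapTorsion W _ hdiv (a • P₁ + t) := by rw [hP]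
    _ = m₀ • (p ^ v • (a • kummerMapTorsion W _ hdiv P₁)) +
          p ^ v • (m₀ • kummerMapTorsion W _ hdiv t) := by
        rw [map_add, map_zsmul, smul_add, mul_comm, mul_nsmul', mul_comm, mul_nsmul']
    _ = 0 := by rw [hPart1, hPart2, smul_zero, smul_zero, add_zero]

end Literature.NumberTheory.EllipticCurves

end
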